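import Summits.Parity.GeneralizedHardyLittlewood.Theorems.GreenTaoLevelTwoGITwoCyclicInverseCircleCutoff
import Summits.Parity.GeneralizedHardyLittlewood.Theorems.GreenTaoLevelTwoGITwoCyclicInverseTensorProduct
import Literature.NumberTheory.Sieve.LinearEquationsInPrimesLevelTwoInputs

/-!
# Route `GreenTaoLevelTwo`, crux `GITwo` (stmt-Parity-21275), line `birth`, stub `stub_cyclicInverse`:
# functions on the `2`-torus as nilsequences on `circle × circle` (GT08a arXiv Lemma 69, the
# "direct sum of two copies of the unit circle shift")

Sixty-fifth helper file toward the XL stub `stub_cyclicInverse` (B. Green, T. Tao, *An inverse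
theorem for the Gowers `U³(G)` norm*, arXiv:math/0503014, Thm. 68 = PEMS 51 (2008) Thm. 12.8).
Block E16 (arXiv §12, proof of Lemma 69): "This function may be identified as the elementary
nilsequence `F_{N,(ξ/N,qξ/N),0}`, where the underlying nilmanifold `G/Γ` is the direct sum of two
copies of the unit circle shift (i.e. it is the torus `(ℝ/ℤ)²`) and `F(x,y) := χ(x)e(sx)e(y)`" and
"`F(x,y) := χ(x)χ(y)e(sxy)` when `−1/2 < x,y ≤ 1/2`".  In the tree the torus member of the
Heisenberg class is `(circle.ofLE _).prod (circle.ofLE _)` (`InHeisClass.prod .circle .circle`).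
Def-free:

* `norm_sub_le_of_vanishing_near_seam₂` — the two-variable seam lemma: a `1`-bounded
  `Ψ : ℝ/ℤ → ℝ/ℤ → ℂ` vanishing when `‖a‖ ≥ r₂` or `‖b‖ ≥ r₂` (`r₂ < ½`) and `L`-Lipschitz along
  representatives in each variable is `2(L + 2/(½−r₂))`-Lipschitz for the max metric;
* `exists_torus_realisation` — every `1`-bounded `Ψ` that is `M`-Lipschitz for the max metric and
  all `θ₁, θ₂, x₁, x₂` give `Φ, g, p₀` on `(circle.ofLE h).prod (circle.ofLE h)` with
  `Φ(gⁿp₀) = Ψ(x₁ + nθ₁, x₂ + nθ₂)` (`n ∈ ℤ`), `Φ` `1`-bounded and `M`-Lipschitz.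

References: [GreenTao2008U3Inverse] arXiv:math/0503014, §12, proof of Lemma 69.
-/

noncomputable section

namespace Summit.Parity.GeneralizedHardyLittlewood.GreenTaoLevelTwoGITwoCyclicInverse

open Literature.NumberTheory.Sieve

/-- **Two-variable seam lemma.**  Let `Ψ : ℝ/ℤ → ℝ/ℤ → ℂ` be `1`-bounded, vanish whenever
`‖a‖ ≥ r₂` or `‖b‖ ≥ r₂` (`r₂ < ½`), and satisfy `‖Ψ(x,b) − Ψ(y,b)‖ ≤ L|x−y|` and
`‖Ψ(a,x) − Ψ(a,y)‖ ≤ L|x−y|` for representatives `|x|,|y| ≤ ½`, `|x−y| ≤ ½`.  Then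
`‖Ψ a b − Ψ a' b'‖ ≤ 2(L + 2/(½−r₂)) · max (dist a a') (dist b b')`.
[cite: GreenTao2008U3Inverse, §12, proof of Lemma 69] -/
theorem norm_sub_le_of_vanishing_near_seam₂ {Ψ : AddCircle (1 : ℝ) → AddCircle (1 : ℝ) → ℂ}
    {r₂ L : ℝ} (hr : r₂ < 1 / 2) (hL : 0 ≤ L) (hb : ∀ a b, ‖Ψ a b‖ ≤ 1)
    (hvan₁ : ∀ a b, r₂ ≤ ‖a‖ → Ψ a b = 0) (hvan₂ : ∀ a b, r₂ ≤ ‖b‖ → Ψ a b = 0)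
    (hlip₁ : ∀ (b : AddCircle (1 : ℝ)) (x y : ℝ), |x| ≤ 1 / 2 → |y| ≤ 1 / 2 → |x - y| ≤ 1 / 2 →
      ‖Ψ (x : AddCircle (1 : ℝ)) b - Ψ (y : AddCircle (1 : ℝ)) b‖ ≤ L * |x - y|)
    (hlip₂ : ∀ (a : AddCircle (1 : ℝ)) (x y : ℝ), |x| ≤ 1 / 2 → |y| ≤ 1 / 2 → |x - y| ≤ 1 / 2 →
      ‖Ψ a (x : AddCircle (1 : ℝ)) - Ψ a (y : AddCircle (1 : ℝ))‖ ≤ L * |x - y|)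
    (a b a' b' : AddCircle (1 : ℝ)) :
    ‖Ψ a b - Ψ a' b'‖ ≤ 2 * (L + 2 / (1 / 2 - r₂)) * max (dist a a') (dist b b') := by
  have hK : 0 ≤ L + 2 / (1 / 2 - r₂) := add_nonneg hL (div_nonneg zero_le_two (by linarith))
  -- slice in the first variable (at `b`), then in the second (at `a'`)
  have h1 : ‖Ψ a b - Ψ a' b‖ ≤ (L + 2 / (1 / 2 - r₂)) * dist a a' :=
    norm_sub_le_of_vanishing_near_seam (Ψ := fun c => Ψ c b) hr hL (fun c => hb c b)
      (fun c hc => hvan₁ c b hc) (fun x y hx hy hxy => hlip₁ b x y hx hy hxy) a a'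
  have h2 : ‖Ψ a' b - Ψ a' b'‖ ≤ (L + 2 / (1 / 2 - r₂)) * dist b b' :=
    norm_sub_le_of_vanishing_near_seam (Ψ := fun c => Ψ a' c) hr hL (fun c => hb a' c)
      (fun c hc => hvan₂ a' c hc) (fun x y hx hy hxy => hlip₂ a' x y hx hy hxy) b b'
  calc ‖Ψ a b - Ψ a' b'‖ = ‖(Ψ a b - Ψ a' b) + (Ψ a' b - Ψ a' b')‖ := by rw [sub_add_sub_cancel]
    _ ≤ ‖Ψ a b - Ψ a' b‖ + ‖Ψ a' b - Ψ a' b'‖ := norm_add_le _ _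
    _ ≤ (L + 2 / (1 / 2 - r₂)) * dist a a' + (L + 2 / (1 / 2 - r₂)) * dist b b' := add_le_add h1 h2
    _ ≤ (L + 2 / (1 / 2 - r₂)) * max (dist a a') (dist b b') +
          (L + 2 / (1 / 2 - r₂)) * max (dist a a') (dist b b') :=
        add_le_add (mul_le_mul_of_nonneg_left (le_max_left _ _) hK)
          (mul_le_mul_of_nonneg_left (le_max_right _ _) hK)
    _ = 2 * (L + 2 / (1 / 2 - r₂)) * max (dist a a') (dist b b') := by ring

/-- **Torus nilsequences (arXiv Lemma 69, "direct sum of two copies of the unit circle shift").**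
Every `1`-bounded `Ψ : ℝ/ℤ → ℝ/ℤ → ℂ` which is `M`-Lipschitz for the max metric, and all rotations
`θ₁, θ₂` with base point `(x₁, x₂)`, give a `1`-bounded `M`-Lipschitz `Φ` on the product of two
Heisenberg-class circles with `Φ(gⁿ p₀) = Ψ(x₁ + nθ₁, x₂ + nθ₂)` for all `n ∈ ℤ`.
[cite: GreenTao2008U3Inverse, §12, proof of Lemma 69] -/
theorem exists_torus_realisation (Ψ : AddCircle (1 : ℝ) → AddCircle (1 : ℝ) → ℂ) {M : ℝ}
    (hb : ∀ a b, ‖Ψ a b‖ ≤ 1)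
    (hL : ∀ a b a' b', ‖Ψ a b - Ψ a' b'‖ ≤ M * max (dist a a') (dist b b'))
    (θ₁ θ₂ x₁ x₂ : ℝ) (h12 : 1 ≤ 2) :
    ∃ (Φ : ((Nilmanifold.circle.ofLE h12).prod (Nilmanifold.circle.ofLE h12)).G ⧸
          ((Nilmanifold.circle.ofLE h12).prod (Nilmanifold.circle.ofLE h12)).Γ → ℂ)
      (g : ((Nilmanifold.circle.ofLE h12).prod (Nilmanifold.circle.ofLE h12)).G)
      (p₀ : ((Nilmanifold.circle.ofLE h12).prod (Nilmanifold.circle.ofLE h12)).G ⧸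
          ((Nilmanifold.circle.ofLE h12).prod (Nilmanifold.circle.ofLE h12)).Γ),
      (∀ y, ‖Φ y‖ ≤ 1) ∧
      (∀ y z, ‖Φ y - Φ z‖ ≤
        M * ((Nilmanifold.circle.ofLE h12).prod (Nilmanifold.circle.ofLE h12)).dist y z) ∧
      ∀ n : ℤ, Φ (g ^ n • p₀) =
        Ψ ((x₁ + n * θ₁ : ℝ) : AddCircle (1 : ℝ)) ((x₂ + n * θ₂ : ℝ) : AddCircle (1 : ℝ)) := by
  set X := Nilmanifold.circle.ofLE h12 with hX
  obtain ⟨p₀, hp₀⟩ := exists_quotientProdMap_eq X X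
    (QuotientGroup.mk (Multiplicative.ofAdd x₁) : Nilmanifold.circle.G ⧸ Nilmanifold.circle.Γ)
    (QuotientGroup.mk (Multiplicative.ofAdd x₂) : Nilmanifold.circle.G ⧸ Nilmanifold.circle.Γ)
  refine ⟨fun p => Ψ (Nilmanifold.quotientProdMap X X p).1 (Nilmanifold.quotientProdMap X X p).2,
    ((Multiplicative.ofAdd θ₁, Multiplicative.ofAdd θ₂) : Nilmanifold.circle.G × Nilmanifold.circle.G),
    p₀, fun p => hb _ _, fun p q => ?_, fun n => ?_⟩
  · -- Lipschitz for the max metric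
    have := hL (Nilmanifold.quotientProdMap X X p).1 (Nilmanifold.quotientProdMap X X p).2
      (Nilmanifold.quotientProdMap X X q).1 (Nilmanifold.quotientProdMap X X q).2
    refine this.trans (le_of_eq ?_)
    rw [prod_dist_eq]
    rfl
  · -- the orbit
    have horb := quotientProdMap_zpow_smul X X
      ((Multiplicative.ofAdd θ₁, Multiplicative.ofAdd θ₂) : Nilmanifold.circle.G × Nilmanifold.circle.G)
      p₀ n
    show Ψ _ _ = Ψ _ _
    rw [horb, hp₀]
    have e : ∀ (γ : X.G) (θ x₀ : ℝ), γ = Multiplicative.ofAdd θ →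
        γ ^ n • (QuotientGroup.mk (Multiplicative.ofAdd x₀) : X.G ⧸ X.Γ) =
          (((x₀ + n * θ : ℝ)) : AddCircle (1 : ℝ)) := by
      intro γ θ x₀ hγ
      rw [hγ]
      show (QuotientGroup.mk ((Multiplicative.ofAdd θ) ^ n * Multiplicative.ofAdd x₀) :
          Nilmanifold.circle.G ⧸ Nilmanifold.circle.Γ) = _
      rw [← ofAdd_zsmul, ← ofAdd_add, zsmul_eq_mul, add_comm]
      rfl
    congr 1
    · exact e _ θ₁ x₁ rfl
    · exact e _ θ₂ x₂ rfl

end Summit.Parity.GeneralizedHardyLittlewood.GreenTaoLevelTwoGITwoCyclicInverse
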